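import Mathlib
import Literature.Probability.Percolation.DisjointOccurrencePow
import Literature.Probability.Percolation.PlanarDuality
import Summits.CriticalPhenomena.PercolationContinuityZ3.Theses.PercNonProliferation
import HarnessLib

/-!
# CriticalPhenomena / PercolationContinuityZ3 — route PercNonProliferation, item `SpanningBKCap`

Item `stmt-CriticalPhenomena-4451` (support, rank 9) of route
`route-CriticalPhenomena-PercNonProliferation`: the **BK cap on the number of spanning
box-clusters**. For every `p`, `k`, `n`,

`P_p(∃ k+1 points of B(n), pairwise not joined inside B(2n), each joined inside B(2n) to ∂⁻B(2n))
  ≤ P_p(B(n) ↔ ∂⁻B(2n) inside B(2n))^{k+1}`.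

Proof (Grimmett, *Percolation* (1999), §2.3, Thm (2.12) and (2.14)/(2.17); van den Berg–Kesten
1985; Reimer 2000): the `k+1` points lie in pairwise distinct clusters of the open graph induced
on `B(2n)`, so the open walks joining them to `∂⁻B(2n)` inside `B(2n)` have pairwise disjoint
edge sets (a shared edge has an endpoint joined inside `B(2n)` to both points); these edge sets
are `k+1` pairwise disjoint open witnesses of the increasing local crossing event
`A = {B(n) ↔ ∂⁻B(2n) inside B(2n)} = openCrossing ↑B(2n) ↑B(n) ↑∂⁻B(2n)`, whence the event lies
in the iterated disjoint occurrence `A □ ⋯ □ A` (`k+1` factors,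
`Literature.Probability.Percolation.mem_disjointOccurrencePow_of_pairwise_disjoint`), whose
probability is at most `P_p(A)^{k+1}` by the iterated BK–Reimer inequality
`Literature.Probability.Percolation.measureReal_disjointOccurrencePow_le`.

The combinatorial inclusion is proved for an arbitrary vertex type and arbitrary region /
source / target sets (`setOf_distinctClusters_subset_disjointOccurrencePow`).
-/

namespace Summit.CriticalPhenomena.PercolationContinuityZ3.Theorems

open MeasureTheory Literature.Probability.Percolation Literature.Probability.LatticeModels

section Combinatorics

variable {V : Type*}

/-- A configuration in `{x ↔ y in S}` carries an open walk from `x` to `y` all of whose vertices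
lie in `S` (the induced-graph walk pushed forward to the open graph). [folklore] -/
theorem exists_openWalk_of_mem_openConnIn {ω : BondConfig V} {S : Set V} {x y : V}
    (h : ω ∈ openConnIn S x y) :
    ∃ q : (openGraph ω).Walk x y, ∀ z ∈ q.support, z ∈ S := by
  obtain ⟨hx, hy, ⟨w⟩⟩ := h
  have hS : ∀ z ∈ (w.map (SimpleGraph.Embedding.induce S).toHom).support, z ∈ S := by
    intro z hz
    rw [SimpleGraph.Walk.support_map] at hz
    obtain ⟨u, -, rfl⟩ := List.mem_map.1 hz
    exact u.2
  exact ⟨w.map (SimpleGraph.Embedding.induce S).toHom, hS⟩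

/-- **Distinct clusters give disjoint crossing witnesses.** If `k+1` points of `A` are each
joined inside `S` to `B` but pairwise not joined inside `S`, then the crossing event
`openCrossing S A B` occurs `k+1` times disjointly: the edge sets of the `k+1` open walks are
pairwise disjoint open witnesses (a common edge would join two of the points inside `S`).
(Grimmett 1999, §2.3, (2.17): "there exist disjoint open paths `π₁ ∈ Π₁, …, π_k ∈ Π_k`".)
[folklore] -/
theorem setOf_distinctClusters_subset_disjointOccurrencePow (S A B : Set V) (k : ℕ) :
    {ω : BondConfig V | ∃ x : Fin (k + 1) → V, (∀ i, x i ∈ A) ∧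
        (∀ i, ∃ y ∈ B, ω ∈ openConnIn S (x i) y) ∧
        ∀ i j, i ≠ j → ω ∉ openConnIn S (x i) (x j)} ⊆
      disjointOccurrencePow (openCrossing S A B) (k + 1) := by
  classical
  rintro ω ⟨x, hxA, hconn, hsep⟩
  choose y hyB hy using hconn
  have hw : ∀ i, ∃ q : (openGraph ω).Walk (x i) (y i), ∀ z ∈ q.support, z ∈ S :=
    fun i => exists_openWalk_of_mem_openConnIn (hy i)
  choose w hwS using hw
  -- the witnesses: the edge sets of the walks
  refine mem_disjointOccurrencePow_of_pairwise_disjoint (isUpperSet_openCrossing S A B)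
    (fun i => {e | e ∈ (w i).edges}) (fun i e he => ?_) (fun i => ?_) (fun i j hij => ?_)
  · -- open
    exact edgeSet_openGraph_subset ω ((w i).edges_subset_edgeSet he)
  · -- each witness realises the crossing
    exact ⟨x i, hxA i, y i, hyB i, mem_openConnIn_of_walk (w i) (hwS i) fun e he => he⟩
  · -- pairwise disjoint: a common edge joins `x i` to `x j` inside `S`
    refine Set.disjoint_left.2 fun e hei hej => ?_
    simp only [Set.mem_setOf_eq] at hei hej
    induction e using Sym2.ind with
    | h u v =>
      have hui : u ∈ (w i).support := (w i).fst_mem_support_of_mem_edges hei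
      have huj : u ∈ (w j).support := (w j).fst_mem_support_of_mem_edges hej
      have hi : ω ∈ openConnIn S (x i) u :=
        mem_openConnIn_of_mem_support (w i) (hwS i)
          (fun e he => edgeSet_openGraph_subset ω ((w i).edges_subset_edgeSet he)) hui
      have hj : ω ∈ openConnIn S (x j) u :=
        mem_openConnIn_of_mem_support (w j) (hwS j)
          (fun e he => edgeSet_openGraph_subset ω ((w j).edges_subset_edgeSet he)) huj
      rw [openConnIn_comm] at hj
      exact hsep i j hij (PlanarDuality.openConnIn_trans hi hj)

end Combinatorics

/-- **BK cap on the spanning count** — settles item `stmt-CriticalPhenomena-4451` (route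
`PercNonProliferation`, decl `SpanningBKCap`, exact signature): for every `p`, `k`, `n`,
`P_p(∃ k+1 points of B(n) pairwise unjoined inside B(2n), each joined inside B(2n) to ∂⁻B(2n))
≤ P_p(B(n) ↔ ∂⁻B(2n) inside B(2n))^{k+1}`. The event on the left lies in the `(k+1)`-fold
disjoint occurrence of the local increasing crossing event on the right
(`setOf_distinctClusters_subset_disjointOccurrencePow`), and the iterated BK–Reimer inequality
`measureReal_disjointOccurrencePow_le` bounds the latter (Grimmett 1999, Thm (2.12), (2.14),
(2.17); van den Berg–Kesten 1985; Reimer 2000). [folklore] -/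
theorem spanningBKCap_proof :
    Summit.CriticalPhenomena.PercolationContinuityZ3.Theses.PercNonProliferation.SpanningBKCap := by
  intro p k n
  have hA : IsLocalEvent (openCrossing (↑(box 3 (2 * n)) : Set (Site 3)) ↑(box 3 n)
      ↑(innerBoundary (zdGraph 3) (box 3 (2 * n)))) :=
    isLocalEvent_openCrossing _ _ _
  exact (measureReal_mono (setOf_distinctClusters_subset_disjointOccurrencePow
      (↑(box 3 (2 * n)) : Set (Site 3)) ↑(box 3 n)
      ↑(innerBoundary (zdGraph 3) (box 3 (2 * n))) k)).trans
    (measureReal_disjointOccurrencePow_le (zdGraph 3) p hA (k + 1))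

end Summit.CriticalPhenomena.PercolationContinuityZ3.Theorems
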